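import Literature.NumberTheory.GelbartRogawski1991.LocalKudlaSplittingRigidity
import Literature.NumberTheory.Automorphic.UnitaryGroupSplitPlace
import Literature.NumberTheory.Automorphic.Liu2021.LemD1SplitPlaceOfFacts
import Literature.LinearAlgebra.Matrix.GeneralLinearGroupHomDet
import HarnessLib

/-!
# At a SPLIT place every character of the doubled unitary group `H(F_v) = U(J ⊕ −J)(F_v)` trivial on the Siegel parabolic
# `P_Δ(F_v)` is trivial — THEOREMS ONLY

Topic `NumberTheory/GelbartRogawski1991`; namespace `Literature.NumberTheory.GelbartRogawski1991.UnitaryDualPair.LocalSplitting`.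
The SPLIT-PLACE twin of §3 of `LocalKudlaSplittingRigidity.lean` (`eq_one_of_forall_isSiegelDelta_eq_one`, non-split places),
in the same currency (`IsSiegelDelta`, `UnitaryGroup.localPi E c (n + n) JD v`, `JD = (gramD F n T₀).map (algebraMap F E)`), with
the same proof skeleton: every `h ∈ H(F_v)` has `det h = z / σ z` for a unit `z` of `E_v` (Hilbert 90), `z / σz` is the
determinant of a Siegel Levi element `p` (`exists_isSiegelDelta_det_eq`, any place), and a character into a commutative group
kills `h p⁻¹` (determinant `1`).  At a split place the two field-dependent inputs are replaced:

* §1 `exists_unit_mul_conj_eq_of_split` — **Hilbert 90 for `E_v = E_w × E_w̄`** with `σ` the swap: a norm-one `λ`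
  (`σλ · λ = 1`) is `z / σz` for the unit `z = (1, λ_{w̄})` (componentwise: `λ_w · c(λ_{w̄}) = 1`, `λ_{w̄} · c(1) = λ_{w̄}`);
* §2 `doubled_localPi_apply_eq_one_of_det_eq_one_of_split` — **a character of `H(F_v)` into a commutative group kills the
  determinant-one elements**: at a split place `H(F_v) ≅ GL_{2n}(E_w)` by the projection `u ↦ u_w`
  (`UnitaryGroup.localPiSplitEquiv`), under which `det` becomes the `w`-component of `det` (`GLn.map_piEquiv_symm`,
  `RingHom.map_det`), and characters of `GL_m(K)` kill `SL_m(K)` for `K ≠ 𝔽₂` (`GLHomDet.apply_eq_one_of_det_eq_one`,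
  [Artin1988, Chap. IV Thm. 4.6]);
* §3 `eq_one_of_forall_isSiegelDelta_eq_one_of_split` (a `c`-moved place `w ∣ v` given) and
  `eq_one_of_forall_isSiegelDelta_eq_one_of_not_isField` (`¬ IsField E_v`): the statement of the non-split theorem, verbatim,
  at a split place.

Written for the cell `hodgecm-mathlib` (Kudla-splitting rigidity `eq_of_parabolic_toRep_conj_eq`'s hypothesis `hκ` at split
places; consumer: the line-isometry naturality S6a of the a4-liuD3 closers).  No definition, no named fact, debt Δ 0; HC_CM is
NOT proved here.

## References
* [Dieudonne1971GroupesClassiques] J. Dieudonné, *La géométrie des groupes classiques* (1971), Chap. II §1–§2 (`GL_n`,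
  `SL_n = [GL_n, GL_n]`), §5.
* [Artin1988] E. Artin, *Geometric Algebra*, Chap. IV Thm. 4.6.
* [CasselsFrohlichANT1967] Cassels–Fröhlich, *Algebraic Number Theory*, Ch. II §10 (`L ⊗_K K_v = ∏_{w∣v} L_w`).
* [Kudla1994] S. Kudla, Israel J. Math. 87 (1994), §3, Thm. 3.1.
-/

set_option autoImplicit false

noncomputable section

open NumberField IsDedekindDomain MeasureTheory Matrix
open Literature.RepresentationTheory.HeisenbergGroup
open Literature.NumberTheory.Automorphic Literature.NumberTheory.Automorphic.UnitaryGroup Literature.NumberTheory.Weil1964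
open Literature.NumberTheory.GelbartRogawski1991.AdaptedBlocks

namespace Literature.NumberTheory.GelbartRogawski1991.UnitaryDualPair.LocalSplitting

variable (F : Type) [Field F] [NumberField F] (E : Type) [Field E] [NumberField E] [Algebra F E]
  [Algebra.IsQuadraticExtension F E] (c : E ≃ₐ[F] E)
  {δ : E} (hcδ : c δ = -δ) (hδ : δ ≠ 0) {d : F} (hd : δ * δ = algebraMap F E d)
  (v : HeightOneSpectrum (𝓞 F))

/-! ## §1 Hilbert 90 at a split place -/

section Hilbert

omit [NumberField F] [NumberField E] [Algebra.IsQuadraticExtension F E] in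
/-- at a place `w ∣ v` moved by `c`, `c ≠ 1`. [folklore] -/
private theorem hc_of_hw' {w : PlacesOver E v} (hw : c • w.1 ≠ w.1) : c ≠ 1 := by
  rintro rfl; exact hw (one_smul _ _)

/-- **Hilbert 90 at a SPLIT place, by hand**: if `w ∣ v` is moved by `c` (so `E_v = E_w × E_{c⁻¹w}` with `c ⊗ 1` exchanging
the factors), every norm-one `λ ∈ E_v` (`σλ · λ = 1`) is `z / σz` for a unit `z`: take `z_w = 1`, `z_{c⁻¹ w} = λ_{c⁻¹ w}`.
[cite: CasselsFrohlichANT1967, Ch. II §10] -/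
theorem exists_unit_mul_conj_eq_of_split (w : PlacesOver E v) (hw : c • w.1 ≠ w.1) (lam : LocalRing E v)
    (hlam : conjLocal E c v lam * lam = 1) : ∃ z : (LocalRing E v)ˣ, lam * conjLocal E c v z = z := by
  classical
  have hc : c ≠ 1 := hc_of_hw' F E c v hw
  have hlam' : lam * conjLocal E c v lam = 1 := by rw [mul_comm]; exact hlam
  -- the unit `z = (1 at w, λ elsewhere)` with inverse `(1 at w, σλ elsewhere)`
  let zv : LocalRing E v := fun w' => if w' = w then 1 else lam w'
  let zi : LocalRing E v := fun w' => if w' = w then 1 else conjLocal E c v lam w'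
  have hzz : zv * zi = 1 := by
    funext w'
    change (if w' = w then (1 : w'.1.adicCompletion E) else lam w') *
        (if w' = w then (1 : w'.1.adicCompletion E) else conjLocal E c v lam w') = 1
    by_cases h : w' = w
    · rw [if_pos h, if_pos h, one_mul]
    · rw [if_neg h, if_neg h]
      exact congrFun hlam' w'
  refine ⟨⟨zv, zi, hzz, by rw [mul_comm]; exact hzz⟩, ?_⟩
  funext w'
  change lam w' * conjLocal E c v zv w' = zv w'
  rw [conjLocal_apply]
  change lam w' * galAdicCompletionMap c (smul_inv_smul c w'.1)
      (if PlacesOver.galInv c w' = w then (1 : (PlacesOver.galInv c w').1.adicCompletion E)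
        else lam (PlacesOver.galInv c w')) =
    if w' = w then (1 : w'.1.adicCompletion E) else lam w'
  rcases PlacesOver.eq_or_eq_galInv c hc w w' with rfl | rfl
  · -- at `w`: `λ_w · c(λ_{c⁻¹w}) = (λ σλ)_w = 1`
    rw [if_neg (PlacesOver.galInv_ne c w' hw), if_pos rfl]
    have := congrFun hlam' w'
    rw [Pi.mul_apply, conjLocal_apply, Pi.one_apply] at this
    exact this
  · -- at `c⁻¹ w`: `λ · c(1) = λ`
    rw [if_pos (PlacesOver.galInv_galInv c hc w), if_neg (PlacesOver.galInv_ne c w hw), map_one, mul_one]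

end Hilbert

/-! ## §2 Characters of `H(F_v)` kill the determinant-one elements at a split place -/

section DetOne

variable (n : ℕ) {T₀ : Matrix (Fin n) (Fin n) F} {JD : Matrix (Fin (n + n)) (Fin (n + n)) E}

/-- **a character of `H(F_v)` into a commutative group kills every element of determinant `1`, at a SPLIT place**:
`H(F_v) ≅ GL_{2n}(E_w)` by `u ↦ u_w` (`UnitaryGroup.localPiSplitEquiv`), `det u = 1` gives `det u_w = 1`
(`w`-component), and characters of `GL_m(E_w)` kill `SL_m(E_w)` (`GLHomDet.apply_eq_one_of_det_eq_one`; `E_w ≠ 𝔽₂`).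
[cite: Artin1988, Chap. IV Thm. 4.6] [cite: Dieudonne1971GroupesClassiques, Chap. II §1] -/
theorem doubled_localPi_apply_eq_one_of_det_eq_one_of_split (hT₀ : T₀.IsSymm) (hT₀d : IsUnit T₀.det)
    (hJD : JD = (gramD F n T₀).map (algebraMap F E)) (w : PlacesOver E v) (hw : c • w.1 ≠ w.1)
    {A : Type*} [CommGroup A] (θ : UnitaryGroup.localPi E c (n + n) JD v →* A) (u : UnitaryGroup.localPi E c (n + n) JD v)
    (hu : Matrix.GeneralLinearGroup.det
      ((UnitaryGroup.localPiEquiv E c (n + n) JD v u : UnitaryGroup.«local» E c (n + n) JD v) :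
        GL (Fin (n + n)) (LocalRing E v)) = 1) : θ u = 1 := by
  classical
  have hc : c ≠ 1 := hc_of_hw' F E c v hw
  -- `J^𝔻` is hermitian (it is real symmetric) and invertible at `w`
  have hJh : (JD.map c)ᵀ = JD := by
    rw [hJD, Matrix.map_map]
    have h : (⇑c ∘ ⇑(algebraMap F E)) = ⇑(algebraMap F E) := funext fun t => c.commutes t
    rw [h, ← Matrix.transpose_map, (gramD_isSymm F n hT₀).eq]
  have hJu : IsUnit JD := by
    rw [Matrix.isUnit_iff_isUnit_det, hJD, ← RingHom.mapMatrix_apply, ← RingHom.map_det]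
    exact (isUnit_det_gramD F n hT₀d).map _
  have hJw : IsUnit (placeForm JD w.1) := isUnit_placeForm _ hJu w.1
  -- the split model `u ↦ u_w`
  set e := UnitaryGroup.localPiSplitEquiv c JD hc hJh w hw hJw with he
  -- `det u_w = 1`: the `w`-component of `det u = 1`
  have hdet : Matrix.GeneralLinearGroup.det (e u) = 1 := by
    refine Units.ext ?_
    rw [Matrix.GeneralLinearGroup.val_det_apply, Units.val_one, he, UnitaryGroup.localPiSplitEquiv_apply,
      ← GLn.map_piEquiv_symm _ _ (u : UnitaryGroup.LocalGLPi E (n + n) v) w, ← RingHom.mapMatrix_apply, ← RingHom.map_det]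
    have h1 := congrArg (fun x : (LocalRing E v)ˣ => (x : LocalRing E v) w) hu
    simp only [Matrix.GeneralLinearGroup.val_det_apply, Units.val_one, Pi.one_apply] at h1
    exact h1
  -- characters of `GL_{2n}(E_w)` kill `SL_{2n}(E_w)`
  have hK : ∃ a : w.1.adicCompletion E, a ≠ 0 ∧ a ≠ 1 := by
    refine ⟨algebraMap E (w.1.adicCompletion E) 2, (map_ne_zero _).2 two_ne_zero, fun h => ?_⟩
    rw [← map_one (algebraMap E (w.1.adicCompletion E))] at h
    exact absurd ((algebraMap E (w.1.adicCompletion E)).injective h) (by norm_num)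
  have key := Literature.LinearAlgebra.Matrix.GLHomDet.apply_eq_one_of_det_eq_one hK
    (θ.comp e.symm.toMulEquiv.toMonoidHom) hdet
  rw [MonoidHom.comp_apply] at key
  change θ (e.symm (e u)) = 1 at key
  rwa [e.symm_apply_apply] at key

end DetOne

/-! ## §3 Characters of `H(F_v)` trivial on `P_Δ(F_v)` are trivial, at a split place -/

section Split

variable (n : ℕ) {T₀ : Matrix (Fin n) (Fin n) F} {JD : Matrix (Fin (n + n)) (Fin (n + n)) E}

include hcδ hδ hd in
/-- **at a SPLIT place, every character of `H(F_v) = U(J ⊕ −J)(F_v)` with values in a commutative group and trivial on the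
Siegel parabolic `P_Δ(F_v)` is trivial** (diagonal `T₀`, `n ≥ 1`; a `c`-moved place `w ∣ v` given): `θ` kills the
determinant-one elements (§2) and every `det h` (norm one: `conj_det_mul_det_eq_one`) is `z/σz` (§1) = the determinant of a
Siegel Levi element `p` (`exists_isSiegelDelta_det_eq`), so `h = (h p⁻¹) p` with `det (h p⁻¹) = 1`, `p ∈ P_Δ`.
[cite: Dieudonne1971GroupesClassiques, Chap. II §5] [cite: Kudla1994, Thm 3.1] -/
theorem eq_one_of_forall_isSiegelDelta_eq_one_of_split (hn : 0 < n) (t : Fin n → F) (hT₀t : T₀ = Matrix.diagonal t)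
    (hT₀ : T₀.IsSymm) (hT₀d : IsUnit T₀.det) (hJD : JD = (gramD F n T₀).map (algebraMap F E))
    (w : PlacesOver E v) (hw : c • w.1 ≠ w.1) {A : Type*} [CommGroup A] (θ : UnitaryGroup.localPi E c (n + n) JD v →* A)
    (hθ : ∀ p, IsSiegelDelta F E c hcδ hδ hd v n hT₀ hJD p → θ p = 1) : θ = 1 := by
  classical
  refine MonoidHom.ext fun h => ?_
  set ψ := UnitaryGroup.localPiEquiv E c (n + n) JD v with hψ
  -- `det h = z / σ z` (Hilbert 90 at the split place) and the Levi element of that determinant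
  obtain ⟨z, hz⟩ := exists_unit_mul_conj_eq_of_split F E c v w hw _ (conj_det_mul_det_eq_one F E c v n hT₀d hJD h)
  obtain ⟨p, hp, hpdet⟩ := exists_isSiegelDelta_det_eq F E c hcδ hδ hd v n hn t hT₀t hT₀ hJD z
  -- cancel the UNIT `σ z` (no integral-domain hypothesis at a split place)
  have hσz : IsUnit (conjLocal E c v (z : LocalRing E v)) := (Units.isUnit z).map (conjLocal E c v)
  have hdet : ((ψ p : UnitaryGroup.«local» E c (n + n) JD v) : GL (Fin (n + n)) (LocalRing E v)).1.det =
      ((ψ h : UnitaryGroup.«local» E c (n + n) JD v) : GL (Fin (n + n)) (LocalRing E v)).1.det :=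
    hσz.mul_right_cancel (hpdet.trans hz.symm)
  have hu : Matrix.GeneralLinearGroup.det ((ψ p : UnitaryGroup.«local» E c (n + n) JD v) : GL (Fin (n + n)) (LocalRing E v)) =
      Matrix.GeneralLinearGroup.det ((ψ h : UnitaryGroup.«local» E c (n + n) JD v) : GL (Fin (n + n)) (LocalRing E v)) :=
    Units.ext hdet
  have h2 : θ (h * p⁻¹) = 1 := by
    refine doubled_localPi_apply_eq_one_of_det_eq_one_of_split F E c v n hT₀ hT₀d hJD w hw θ _ ?_
    rw [map_mul, map_inv, Subgroup.coe_mul, Subgroup.coe_inv, map_mul, map_inv, hu, mul_inv_cancel]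
  have e : h = h * p⁻¹ * p := by rw [inv_mul_cancel_right]
  rw [e, map_mul, h2, hθ p hp, one_mul, MonoidHom.one_apply]

include hcδ hδ hd in
/-- **the same with the hypothesis `E_v` NOT a field** (a `c`-moved place `w ∣ v` exists, `c ≠ 1` because `c δ = -δ ≠ δ`).
[cite: Dieudonne1971GroupesClassiques, Chap. II §5] [cite: Kudla1994, Thm 3.1] -/
theorem eq_one_of_forall_isSiegelDelta_eq_one_of_not_isField (hn : 0 < n) (t : Fin n → F) (hT₀t : T₀ = Matrix.diagonal t)
    (hT₀ : T₀.IsSymm) (hT₀d : IsUnit T₀.det) (hJD : JD = (gramD F n T₀).map (algebraMap F E))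
    (hE : ¬ IsField (LocalRing E v)) {A : Type*} [CommGroup A] (θ : UnitaryGroup.localPi E c (n + n) JD v →* A)
    (hθ : ∀ p, IsSiegelDelta F E c hcδ hδ hd v n hT₀ hJD p → θ p = 1) : θ = 1 := by
  obtain ⟨w, hw⟩ := Liu2021.SplitPlace.exists_placesOver_smul_ne_of_not_isField E v c
    (UnitaryGroup.algEquiv_ne_one_of_apply_eq_neg F E c hcδ hδ) hE
  exact eq_one_of_forall_isSiegelDelta_eq_one_of_split F E c hcδ hδ hd v n hn t hT₀t hT₀ hT₀d hJD w hw θ hθ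

include hcδ hδ hd in
/-- **ALL finite places**: every character of `H(F_v)` into a commutative group trivial on `P_Δ(F_v)` is trivial (split:
this file; non-split: `eq_one_of_forall_isSiegelDelta_eq_one`). [cite: Dieudonne1971GroupesClassiques, Chap. II §5] [cite: Kudla1994, Thm 3.1] -/
theorem eq_one_of_forall_isSiegelDelta_eq_one' (hn : 0 < n) (t : Fin n → F) (hT₀t : T₀ = Matrix.diagonal t)
    (hT₀ : T₀.IsSymm) (hT₀d : IsUnit T₀.det) (hJD : JD = (gramD F n T₀).map (algebraMap F E))
    {A : Type*} [CommGroup A] (θ : UnitaryGroup.localPi E c (n + n) JD v →* A)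
    (hθ : ∀ p, IsSiegelDelta F E c hcδ hδ hd v n hT₀ hJD p → θ p = 1) : θ = 1 := by
  by_cases hE : IsField (LocalRing E v)
  · exact eq_one_of_forall_isSiegelDelta_eq_one F E c hcδ hδ hd v n hn t hT₀t hT₀ hT₀d hJD hE θ hθ
  · exact eq_one_of_forall_isSiegelDelta_eq_one_of_not_isField F E c hcδ hδ hd v n hn t hT₀t hT₀ hT₀d hJD hE θ hθ

end Split

end Literature.NumberTheory.GelbartRogawski1991.UnitaryDualPair.LocalSplitting

end
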